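import Literature.MathematicalPhysics.QuantumFieldTheory.Balaban1983to89.B9Eq342CovariantResolventAdjointRowTower
import Literature.MathematicalPhysics.QuantumFieldTheory.Balaban1983to89.B9Eq342GreenPrimeTowerDecayRowClosed
import Literature.MathematicalPhysics.QuantumFieldTheory.Balaban1983to89.B9Eq340WeightedHolderRowsProjectionStep
import Literature.MathematicalPhysics.QuantumFieldTheory.Balaban1983to89.B9Eq324PenaltyBlockLocal
import Literature.MathematicalPhysics.QuantumFieldTheory.Balaban1983to89.B9Eq349BlockMultipliers
import Literature.MathematicalPhysics.QuantumFieldTheory.Balaban1983to89.B9Eq347LocalFromBlockDecay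

/-!
# `Balaban1983to89.B9Eq342GreenPrimeDstarValueRowTower` — T. Bałaban, *Propagators for lattice gauge theories in a background field*, Commun. Math. Phys. **99** (1985)
# 389–434 [Balaban1985BackgroundPropagators] Thm 3.1 (3.42) p. 397, THIRD ENTRY WITH ITS DECAY FACTOR `|(G′(U)∇*_Uλ)(x)| ≤ B₀L^jηe^{−δ₀d(y,y′)}|λ|`, FOR PRINT's
# `k`-LEVEL SITE PROPAGATOR `G′_k(U)` (`B9Eq324DeltaPrimeATower.GpOfUk`) ON THE CELL's MODEL: **THE VALUE MEMBER OF (HLa₀) — `∃ αa Ba δa` BEFORE THE HEIGHT such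
# that on print's diagonal window, for every bond datum `f` supported over ONE big block `v` with `‖f‖_∞ ≤ F` and every fine site `x`:
# `‖(G′_k(U)D*_Uf)(x)‖ ≤ Ba·e^{−δa·d_m(Πx, v)}·F`** — by `G′_kD*_U = G_1D*_U + G′_k[(1 − a′Q̃′_k†Q̃′_k)G_1D*_U]` (`G_1 = (Δ^η_U + 1)⁻¹`), this lineage's decayed
# adjoint row of `G_1D*_U` (`B9Eq342CovariantResolventAdjointRowTower`), the big-block locality and the diagonal size `|a′|` of the penalty (ne9-leaf-03's
# `B9Eq324PenaltyBlockLocal`), the OWNER's CLOSED decayed value row of `G′_k` (`B9Eq342GreenPrimeTowerDecayRowClosed.exists_decayRow_GpOfUk`) and the (3.47)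
# summation with exponential weights (`B9Eq340WeightedHolderRowsProjectionStep.weighted_row_of_local`)

statement-level skeleton of published theorems with citation tags; proofs where landed; nothing here is a claim about the Yang–Mills mass gap

CITATION HEADER (lean-in-tree rule).  Audit cell `pub-balaban`, sub-cell `t4`, BINDER row NE9; filed by NE9 crux-team LEAF PROVER 01 (`b2b-balaban-t4-ne9-formalise-leaf-01`,
gen 93; bears_on: R4/N22).  Source READ first-hand (`paper:balaban1985-cmp99-background-propagators`, journal page = PDF page + 388): p. 397 Thm 3.1 (3.42) third member,
p. 394 (3.24)–(3.25) (`Δ′_a = Δ^η_U + Q′*aQ′`, `G′ = (Δ′_a)⁻¹`), p. 396 (3.35), p. 399 (3.49) («supp λ ⊂ Δ(y′)»); p. 398 the random-walk proof — NOT reproduced.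
COMPOSED BY NAME: the files listed in the title; `B9Eq349BlockMultipliers.exists_block_clm_family` (big-block projections), `B9Eq347LocalFromBlockDecay.norm_le_sqrt_mass_mul`.
Nothing printed is a hypothesis; the `[cite: …]` tags are TEXT LOCATIONS.

WHAT IS PROVED (sorry-free; proof lane — 0 `def`; [folklore] composition + one resolvent identity).
* §1 **`GpOfUk_eq_resolvent_add`** — `G′_kh = G_1h + G′_k(G_1h − (Δ′_{a′,k}(U) − Δ^η_U)(G_1h))` for ANY positivity witnesses (`(Δ^η_U + 1)G_1h = h`,
  `Δ′_{a′,k} = Δ^η_U + (Δ′_{a′,k} − Δ^η_U)`).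
* §2 **`exists_valueRow_GpOfUk_covDiv`** — THE VALUE MEMBER OF (HLa₀): `∃ αa Ba δa` first; binders = the OWNER's decayed-row block (`ηL^{n+1} = 1`, `c₀(L^{n+1})^d = c₁`,
  mutually adjoint∕unitary transporters, `U(b) ∈ U1`, `‖U(b) − 1‖ ≤ αη`, the level-average letters `εU`, contractive level transporters, any `hpos′`) plus the model's
  `‖U(x,μ) − U(x−e_μ,μ)‖ ≤ αη²`; conclusion for `f : BondL2K` supported in `Π⁻¹(v)` with `‖f(b)‖ ≤ F`.
HONEST SCOPE.  ONE of the two members of (HLa₀) (the VALUE row of `G′_kD*_U`); the Hölder member (3.43)₂ and (HLb) = (3.44) remain the located open members of STOREY H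
(`B9Eq3152StoreyHTwoHolderMembers`); binder list shorter than the (T4E) block's (docking = instantiation).  Constants crude.  NOT summit progress (cell pub-balaban: NE9 NOT
PRINTED ∕ NOT PROVED; «NE9 ⇐ the named binders»; row WALLED ON A MODEL (O-NE9-1; #5 UNRULED); spine PROVED 0∕9; rung (B)+1 finite T⁴ — NOT infinite volume, NOT mass gap, NOT
BetaPertH, NOT Clay).  HONEST DEPENDENCY (cell line): continuum YM on T⁴ ⇐ BetaPertH ∧ nine spine estimates (0/9 proved); BetaPertH ⇐ (D1) ∧ (D4) ∧ CAP+tail; G-an2-4 gates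
asym, D1 and NE2/3/4.  NEW file; nothing modified.  Net new unproved facts: 0.
-/

noncomputable section

open scoped InnerProductSpace ComplexConjugate BigOperators

namespace Literature.MathematicalPhysics.QuantumFieldTheory.Balaban1983to89.B9Eq342GreenPrimeDstarValueRowTower

open B4Sect5Torus (TSite tdist tdist_nonneg)
open B4Sect5Proof (latticeConst latticeConst_nonneg)
open B7Prop1Explicit (U1)
open B9SectCLatticeCarrier (Bond bpos unshift)
open B9Eq311L2Pairing (WL2)
open B9Eq319QprimeTorus (fineP blockCoord)
open B11Eq103H1Complex (SiteL2K BondL2K covDivL2K covLaplaceSiteK greenK apply_greenK greenK_apply)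
open B9Eq310HessianOperator (adTransportW)
open B9Eq310HessianHermitian (adTransportW_adjoint)
open B9Eq315QTower (towerP UlevOf)
open B9Eq316TowerFlatIsOneStep (towerP_eq_fineP_pow siteCast)
open B9Eq324DeltaPrimeATower (laplacePrimeAk GpOfUk)
open B9Eq349BlockMultipliers (exists_block_clm_family)
open B9Eq342GreenPrimeTowerDecayRowClosed (exists_decayRow_GpOfUk)
open B9Eq342GreenPrimeTowerSupBoundDecay (bigBlock_eq_iff)
open B9Eq342TowerBigBlocks (card_sites_bigBlock_le)
open B9Eq324PenaltyBlockLocal (norm_laplacePrimeAk_sub_covLaplace_apply_le_block_diagonal)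
open B9Eq347LocalFromBlockDecay (norm_le_sqrt_mass_mul)
open B9Eq340WeightedHolderRowsProjectionStep (weighted_row_of_local)
open B9Eq342CovariantResolventAdjointRowLetters (rePos_covLaplaceSiteK_add)
open B9Eq342CovariantResolventAdjointRowTower (exists_decayRow_resolvent_covDiv)

/-! ## §1 The resolvent identity `G′_k = G_1 + G′_k(1 − (Δ′_{a′,k} − Δ^η_U))G_1` -/

section Identity

variable {d : ℕ} (L : ℕ) [NeZero L] (m : Fin d → ℕ) [∀ i, NeZero (m i)] (n : ℕ)
  {𝔸 : Type*} [NormedRing 𝔸] [NormedAlgebra ℂ 𝔸] [CompleteSpace 𝔸] [NormOneClass 𝔸]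
  {W : Type*} [NormedAddCommGroup W] [InnerProductSpace ℂ W] [FiniteDimensional ℂ W] (φ : W ≃ₗ[ℂ] 𝔸) {c₀ : ℝ} [Fact (0 < c₀)]
  (η : ℝ) (U : Bond d (towerP L m (n + 1)) → 𝔸ˣ) {c₁ : ℝ} [Fact (0 < c₁)] (a' : ℝ)
  (hpos' : ∀ x : SiteL2K ℂ d (towerP L m (n + 1)) c₀ W, x ≠ 0 → 0 < RCLike.re ⟪x, laplacePrimeAk L m n φ η U a' (c₁ := c₁) x⟫_ℂ)
  (hpos₁ : ∀ x : SiteL2K ℂ d (towerP L m (n + 1)) c₀ W, x ≠ 0 →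
    0 < RCLike.re ⟪x, ((covLaplaceSiteK (c₀ := c₀) ((η : ℂ))⁻¹ (adTransportW φ U) (adTransportW φ fun b => (U b)⁻¹) + (1 : ℂ) • LinearMap.id :
      SiteL2K ℂ d (towerP L m (n + 1)) c₀ W →ₗ[ℂ] SiteL2K ℂ d (towerP L m (n + 1)) c₀ W)) x⟫_ℂ)

omit [NormOneClass 𝔸] in
/-- **`G′_kh = G_1h + G′_k(G_1h − (Δ′_{a′,k}(U) − Δ^η_U)(G_1h))`** (`G_1 = (Δ^η_U + 1)⁻¹`): with `w = G_1h`, `Δ′_{a′,k}w = Δ^η_Uw + (Δ′ − Δ^η_U)w = h − (w − (Δ′ − Δ^η_U)w)`,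
apply `G′_k`. [folklore] [cite: Balaban1985BackgroundPropagators, (3.24)–(3.25) p.394, (3.23) p.394] -/
theorem GpOfUk_eq_resolvent_add (h : SiteL2K ℂ d (towerP L m (n + 1)) c₀ W) :
    GpOfUk L m n φ η U a' (c₁ := c₁) hpos' h = greenK _ hpos₁ h +
      GpOfUk L m n φ η U a' (c₁ := c₁) hpos' (greenK _ hpos₁ h -
        (laplacePrimeAk L m n φ η U a' (c₁ := c₁) (greenK _ hpos₁ h) -
          covLaplaceSiteK ((η : ℂ))⁻¹ (adTransportW φ U) (adTransportW φ fun b => (U b)⁻¹) (greenK _ hpos₁ h))) := by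
  set w := greenK _ hpos₁ h with hw
  have h1 : covLaplaceSiteK (c₀ := c₀) ((η : ℂ))⁻¹ (adTransportW φ U) (adTransportW φ fun b => (U b)⁻¹) w + w = h := by
    have e := apply_greenK hpos₁ h
    change (covLaplaceSiteK (c₀ := c₀) ((η : ℂ))⁻¹ (adTransportW φ U) (adTransportW φ fun b => (U b)⁻¹) + (1 : ℂ) • LinearMap.id :
      SiteL2K ℂ d (towerP L m (n + 1)) c₀ W →ₗ[ℂ] SiteL2K ℂ d (towerP L m (n + 1)) c₀ W) w = h at e
    rw [LinearMap.add_apply, LinearMap.smul_apply, LinearMap.id_apply, one_smul] at e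
    exact e
  have h2 : laplacePrimeAk L m n φ η U a' (c₁ := c₁) w =
      h - (w - (laplacePrimeAk L m n φ η U a' (c₁ := c₁) w - covLaplaceSiteK ((η : ℂ))⁻¹ (adTransportW φ U) (adTransportW φ fun b => (U b)⁻¹) w)) := by
    rw [← h1]; abel
  have h3 : w = GpOfUk L m n φ η U a' (c₁ := c₁) hpos' h - GpOfUk L m n φ η U a' (c₁ := c₁) hpos' (w -
      (laplacePrimeAk L m n φ η U a' (c₁ := c₁) w - covLaplaceSiteK ((η : ℂ))⁻¹ (adTransportW φ U) (adTransportW φ fun b => (U b)⁻¹) w)) := by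
    have e := congr_arg (GpOfUk L m n φ η U a' (c₁ := c₁) hpos') h2
    rw [map_sub] at e
    rw [← e]
    unfold GpOfUk
    rw [greenK_apply]
  exact sub_eq_iff_eq_add.mp h3.symm

end Identity

/-! ## §2 The value member of (HLa₀): the decayed value row of `G′_kD*_U` on the model -/

section Row

variable {d : ℕ} (L : ℕ) [NeZero L] (hL3 : 3 ≤ L)
  {𝔸 : Type*} [NormedRing 𝔸] [NormedAlgebra ℂ 𝔸] [CompleteSpace 𝔸] [NormOneClass 𝔸] [StarRing 𝔸]
  {W : Type*} [NormedAddCommGroup W] [InnerProductSpace ℂ W] [FiniteDimensional ℂ W] (φ : W ≃ₗ[ℂ] 𝔸)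
  {a' Mφ Mφ' : ℝ} (hMφ : 0 ≤ Mφ) (hMφ' : 0 ≤ Mφ') (hφ : ∀ w, ‖φ w‖ ≤ Mφ * ‖w‖) (hφ' : ∀ X, ‖φ.symm X‖ ≤ Mφ' * ‖X‖) (ha' : 0 < a')
  {r : ℝ} (hr0 : 0 ≤ r) (hr1 : r < 1)
  (τ : 𝔸 →ₗ[ℂ] ℂ) (hτ₂ : ∀ X Y : 𝔸, τ (X * Y) = τ (Y * X)) (hφτ : ∀ X Y : 𝔸, ⟪φ.symm X, φ.symm Y⟫_ℂ = τ (star X * Y))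

include hL3 hMφ hMφ' hφ hφ' ha' hr0 hr1 hτ₂ hφτ in
/-- **[B9] Thm 3.1 (3.42), THIRD ENTRY WITH DECAY, FOR `G′_k(U)D*_U` ON THE MODEL — THE VALUE MEMBER OF (HLa₀), `∃ αa Ba δa` BEFORE THE HEIGHT.**  For `1 ≤ d`, `L ≥ 3`,
`a′ > 0`, the profile ratio `r ∈ [0,1[`, a fibre with norm letters and a compatible trace: there are `αa > 0`, `Ba ≥ 0`, `δa > 0` such that at every height `n`, on print's
diagonal `ηL^{n+1} = 1`, `c₀(L^{n+1})^d = c₁`, for every period `m`, every background `U` of the model (`U(b) ∈ U1`, `‖U(b) − 1‖ ≤ αη`, `‖U(x,μ) − U(x−e_μ,μ)‖ ≤ αη²`,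
`α ≤ αa`, level averages `‖Ū^j(b) − 1‖ ≤ ε_j ≤ αr^j` in `U1`, `U(b)* = U(b)⁻¹`, contractive level transporters), ANY positivity witness `hpos′` of `Δ′_{a′,k}(U)`, every big
block `v`, every bond datum `f` supported in `Π⁻¹(v)` with `‖f(b)‖ ≤ F` and every fine site `x`: `‖(G′_k(U)D*_Uf)(x)‖ ≤ Ba·e^{−δa·d_m(Πx, v)}·F`.
[cite: Balaban1985BackgroundPropagators, Thm 3.1 (3.42) p.397, (3.24)–(3.25) p.394, (3.35) p.396, (3.49) p.399] -/
theorem exists_valueRow_GpOfUk_covDiv (hd : 1 ≤ d) :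
    ∃ αa Ba δa : ℝ, 0 < αa ∧ 0 ≤ Ba ∧ 0 < δa ∧
      ∀ (n : ℕ) (η : ℝ), η * (L : ℝ) ^ (n + 1) = 1 →
      ∀ (c₀ c₁ : ℝ) [Fact (0 < c₀)] [Fact (0 < c₁)], c₀ * ((L : ℝ) ^ (n + 1)) ^ d = c₁ →
      ∀ (m : Fin d → ℕ) [∀ i, NeZero (m i)] (U : Bond d (towerP L m (n + 1)) → 𝔸ˣ),
      ∀ (α : ℝ), 0 ≤ α → α ≤ αa → (∀ b, U b ∈ U1 𝔸) → (∀ b, ‖(U b : 𝔸) - 1‖ ≤ α * η) →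
        (∀ (x : TSite d (towerP L m (n + 1))) (μ : Fin d), ‖(U (x, μ) : 𝔸) - U (unshift μ x, μ)‖ ≤ α * η ^ 2) →
      ∀ (εU : ℕ → ℝ), (∀ j, 0 ≤ εU j) → (∀ j < n + 1, εU j ≤ α * r ^ j) →
        (∀ (j : ℕ) (b : Bond d (towerP L m (j + 1))), ‖(UlevOf L m (n + 1) U j b : 𝔸) - 1‖ ≤ εU j) →
        (∀ (j : ℕ) (b : Bond d (towerP L m (j + 1))), UlevOf L m (n + 1) U j b ∈ U1 𝔸) →
        (∀ b, star (U b : 𝔸) = ((U b)⁻¹ : 𝔸ˣ)) →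
        (∀ (j : ℕ) (b : Bond d (towerP L m (j + 1))) (w : W), ‖adTransportW φ (UlevOf L m (n + 1) U j) b w‖ ≤ ‖w‖) →
      ∀ (hpos' : ∀ x : SiteL2K ℂ d (towerP L m (n + 1)) c₀ W, x ≠ 0 → 0 < RCLike.re ⟪x, laplacePrimeAk L m n φ η U a' (c₁ := c₁) x⟫_ℂ)
        (v : TSite d m) (f : BondL2K ℂ d (towerP L m (n + 1)) c₀ W) (F : ℝ),
        (∀ b, blockCoord (L ^ (n + 1)) m (siteCast (towerP_eq_fineP_pow L m (n + 1)) (bpos b)) ≠ v →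
          WL2.equiv ℂ (fun _ : Bond d (towerP L m (n + 1)) => c₀) W f b = 0) →
        (∀ b, ‖WL2.equiv ℂ (fun _ : Bond d (towerP L m (n + 1)) => c₀) W f b‖ ≤ F) →
        ∀ x : TSite d (towerP L m (n + 1)),
        ‖WL2.equiv ℂ (fun _ : TSite d (towerP L m (n + 1)) => c₀) W
            (GpOfUk L m n φ η U a' (c₁ := c₁) hpos' (covDivL2K ℂ c₀ ((η : ℂ))⁻¹ (adTransportW φ fun b => (U b)⁻¹) f)) x‖ ≤
          Ba * Real.exp (-(δa * tdist m (blockCoord (L ^ (n + 1)) m (siteCast (towerP_eq_fineP_pow L m (n + 1)) x)) v)) * F := by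
  classical
  obtain ⟨α₁, B₁, δ₁, hα₁, hB₁, hδ₁, H1⟩ := exists_decayRow_resolvent_covDiv L hL3 φ hMφ hMφ' hφ hφ' τ hτ₂ hφτ hd
  obtain ⟨αP, CP, ρP, κP, hαP, hCP, hρP, hκP, _hκPρ, _h2κP, HP⟩ := exists_decayRow_GpOfUk L φ hMφ hMφ' hφ hφ' ha' hr0 hr1 τ hτ₂ hφτ hd
  -- the OWNER's constant, the common rate, the assembled constant
  set BP : ℝ := ((1 + |a'| * CP) * (Real.exp (1 / 2) * 2) * (∑ l ∈ Finset.range d, (2 : ℝ) ^ (l + 1)) +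
      Real.sqrt (3 ^ d * 2 ^ d) * Real.sqrt ((Real.exp (1 / 2) * 2) * latticeConst d (Real.sqrt (1 / (4 * d + 1)) - 2 * κP)) * CP) with hBP
  have hBP0 : 0 ≤ BP := by positivity
  obtain ⟨δ₂, hδ₂⟩ : ∃ δ₂ : ℝ, δ₂ = min δ₁ (κP / 2) := ⟨_, rfl⟩
  have hδ₂0 : 0 < δ₂ := by rw [hδ₂]; exact lt_min hδ₁ (half_pos hκP)
  have hδ₂1 : δ₂ ≤ δ₁ := by rw [hδ₂]; exact min_le_left _ _
  have hδ₂κ : δ₂ < κP := by rw [hδ₂]; exact (min_le_right _ _).trans_lt (half_lt_self hκP)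
  have hKc : 0 ≤ latticeConst d (κP - δ₂) := latticeConst_nonneg d (by linarith)
  refine ⟨min α₁ αP, B₁ + BP * latticeConst d (κP - δ₂) * ((1 + |a'|) * B₁), δ₂, lt_min hα₁ hαP, by positivity, hδ₂0, ?_⟩
  intro n η hηL c₀ c₁ _ _ hw m _ U α hα hαle hUb hUη hUgrad εU hεU hεg hUε hLb hUst hRlev hpos' v f F hfv hfF x
  have hc₀ : (0 : ℝ) < c₀ := Fact.out
  have hc₁ : (0 : ℝ) < c₁ := Fact.out
  have hm : ∀ i, 1 ≤ m i := fun i => Nat.one_le_iff_ne_zero.mpr (NeZero.ne (m i))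
  haveI : NeZero (L ^ (n + 1)) := ⟨pow_ne_zero _ (NeZero.ne L)⟩
  have hF : 0 ≤ F := (norm_nonneg _).trans (hfF (x, ⟨0, hd⟩))
  have hαa : α ≤ α₁ := hαle.trans (min_le_left _ _)
  have hαP' : α ≤ αP := hαle.trans (min_le_right _ _)
  have hRS : ∀ (b : Bond d (towerP L m (n + 1))) (v u : W), ⟪adTransportW φ U b v, u⟫_ℂ = ⟪v, adTransportW φ (fun b => (U b)⁻¹) b u⟫_ℂ :=
    adTransportW_adjoint φ τ hτ₂ hUst hφτ
  -- positivity of `Δ^η_U + 1`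
  have hpos₁ : ∀ z : SiteL2K ℂ d (towerP L m (n + 1)) c₀ W, z ≠ 0 →
      0 < RCLike.re ⟪z, ((covLaplaceSiteK (c₀ := c₀) ((η : ℂ))⁻¹ (adTransportW φ U) (adTransportW φ fun b => (U b)⁻¹) + (1 : ℂ) • LinearMap.id :
        SiteL2K ℂ d (towerP L m (n + 1)) c₀ W →ₗ[ℂ] SiteL2K ℂ d (towerP L m (n + 1)) c₀ W)) z⟫_ℂ := by
    have h := rePos_covLaplaceSiteK_add (c₀ := c₀) η⁻¹ one_pos (adTransportW φ U) (adTransportW φ fun b => (U b)⁻¹) hRS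
    simp only [Complex.ofReal_inv, Complex.ofReal_one] at h
    exact h
  -- §0 the decayed adjoint row of `G_1D*_U`
  set w : SiteL2K ℂ d (towerP L m (n + 1)) c₀ W := greenK _ hpos₁ (covDivL2K ℂ c₀ ((η : ℂ))⁻¹ (adTransportW φ fun b => (U b)⁻¹) f) with hwdef
  have hwrow : ∀ y, ‖WL2.equiv ℂ _ W w y‖ ≤ B₁ * Real.exp (-(δ₁ * tdist m (blockCoord (L ^ (n + 1)) m (siteCast (towerP_eq_fineP_pow L m (n + 1)) y)) v)) * F :=
    fun y => H1 n η hηL c₀ m U α hα hαa hUst hUb hUη hUgrad hpos₁ v f F hF hfv hfF y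
  -- the big-block projections
  obtain ⟨PS, hPS⟩ := exists_block_clm_family (𝕜 := ℂ) (w := fun _ : TSite d (towerP L m (n + 1)) => c₀) (V := W)
    (fun x : TSite d (towerP L m (n + 1)) => blockCoord (L ^ (n + 1)) m (siteCast (towerP_eq_fineP_pow L m (n + 1)) x))
  have hPS' : ∀ (y : TSite d m) (g : SiteL2K ℂ d (towerP L m (n + 1)) c₀ W) (x : TSite d (towerP L m (n + 1))),
      WL2.equiv ℂ (fun _ : TSite d (towerP L m (n + 1)) => c₀) W (PS y g) x =
        if (∀ i, (x i : ℕ) / L ^ (n + 1) = (y i : ℕ)) then WL2.equiv ℂ (fun _ : TSite d (towerP L m (n + 1)) => c₀) W g x else 0 := by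
    intro y g x; rw [hPS]; exact if_congr (bigBlock_eq_iff L m n x y) rfl rfl
  have hμS : ∀ y : TSite d m, ∑ x : TSite d (towerP L m (n + 1)),
      (if blockCoord (L ^ (n + 1)) m (siteCast (towerP_eq_fineP_pow L m (n + 1)) x) = y then c₀ else 0) ≤ c₁ := by
    intro y
    rw [← Finset.sum_filter, Finset.sum_const, nsmul_eq_mul, ← hw]
    have h := card_sites_bigBlock_le L m (n + 1) y
    have h' : ((Finset.univ.filter (fun x : TSite d (towerP L m (n + 1)) =>
        blockCoord (L ^ (n + 1)) m (siteCast (towerP_eq_fineP_pow L m (n + 1)) x) = y)).card : ℝ) ≤ ((L : ℝ) ^ (n + 1)) ^ d := by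
      exact_mod_cast h
    rw [mul_comm]
    exact mul_le_mul_of_nonneg_left h' hc₀.le
  -- §1 the correction source `g = w − (Δ′_{a′,k} − Δ^η_U)w` and its decayed bound
  set g : SiteL2K ℂ d (towerP L m (n + 1)) c₀ W := w - (laplacePrimeAk L m n φ η U a' (c₁ := c₁) w -
      covLaplaceSiteK ((η : ℂ))⁻¹ (adTransportW φ U) (adTransportW φ fun b => (U b)⁻¹) w) with hgdef
  have hgrow : ∀ y, ‖WL2.equiv ℂ _ W g y‖ ≤ ((1 + |a'|) * B₁ * F) *
      Real.exp (-(δ₁ * tdist m (blockCoord (L ^ (n + 1)) m (siteCast (towerP_eq_fineP_pow L m (n + 1)) y)) v)) := by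
    intro y
    set y₀ := blockCoord (L ^ (n + 1)) m (siteCast (towerP_eq_fineP_pow L m (n + 1)) y) with hy₀
    have hyy : ∀ i, (y i : ℕ) / L ^ (n + 1) = (y₀ i : ℕ) := (bigBlock_eq_iff L m n y y₀).1 rfl
    have hE0 : 0 ≤ B₁ * Real.exp (-(δ₁ * tdist m y₀ v)) * F := by positivity
    -- the penalty, localised on the block of `y`, against the block mass
    have hpen := norm_laplacePrimeAk_sub_covLaplace_apply_le_block_diagonal L m n φ U hPS' hRlev hw η a' w y y₀ hyy
    have hmass : ‖PS y₀ w‖ ≤ Real.sqrt c₁ * (B₁ * Real.exp (-(δ₁ * tdist m y₀ v)) * F) :=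
      norm_le_sqrt_mass_mul (w := fun _ : TSite d (towerP L m (n + 1)) => c₀)
        (π := fun x : TSite d (towerP L m (n + 1)) => blockCoord (L ^ (n + 1)) m (siteCast (towerP_eq_fineP_pow L m (n + 1)) x))
        y₀ (hμS y₀) (PS y₀ w) hE0 (fun x hx => by rw [hPS, if_neg hx]) (fun x => by
          rw [hPS]
          by_cases hx : blockCoord (L ^ (n + 1)) m (siteCast (towerP_eq_fineP_pow L m (n + 1)) x) = y₀
          · rw [if_pos hx, ← hx]; exact hwrow x
          · rw [if_neg hx, norm_zero]; exact hE0)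
    have hsq : (Real.sqrt c₁)⁻¹ * Real.sqrt c₁ = 1 := inv_mul_cancel₀ (Real.sqrt_pos.2 hc₁).ne'
    rw [hgdef, WL2.equiv_sub, Pi.sub_apply]
    refine (norm_sub_le _ _).trans ?_
    calc ‖WL2.equiv ℂ _ W w y‖ + ‖WL2.equiv ℂ _ W (laplacePrimeAk L m n φ η U a' (c₁ := c₁) w -
            covLaplaceSiteK ((η : ℂ))⁻¹ (adTransportW φ U) (adTransportW φ fun b => (U b)⁻¹) w) y‖
        ≤ B₁ * Real.exp (-(δ₁ * tdist m y₀ v)) * F + |a'| * (Real.sqrt c₁)⁻¹ * (Real.sqrt c₁ * (B₁ * Real.exp (-(δ₁ * tdist m y₀ v)) * F)) :=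
          add_le_add (hwrow y) (hpen.trans (mul_le_mul_of_nonneg_left hmass (by positivity)))
      _ = ((1 + |a'| * ((Real.sqrt c₁)⁻¹ * Real.sqrt c₁)) * B₁ * F) * Real.exp (-(δ₁ * tdist m y₀ v)) := by ring
      _ = ((1 + |a'|) * B₁ * F) * Real.exp (-(δ₁ * tdist m y₀ v)) := by rw [hsq, mul_one]
  -- §2 `G′_k` read on the site functions and its LOCAL decayed row (the OWNER's, closed)
  obtain ⟨T, hT⟩ : ∃ T : (TSite d (towerP L m (n + 1)) → W) →ₗ[ℂ] (TSite d (towerP L m (n + 1)) → W), ∀ q y, T q y =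
      WL2.equiv ℂ (fun _ : TSite d (towerP L m (n + 1)) => c₀) W (GpOfUk L m n φ η U a' (c₁ := c₁) hpos'
        ((WL2.equiv ℂ (fun _ : TSite d (towerP L m (n + 1)) => c₀) W).symm q)) y :=
    ⟨(WL2.linearEquiv ℂ ℂ (fun _ : TSite d (towerP L m (n + 1)) => c₀)).toLinearMap ∘ₗ GpOfUk L m n φ η U a' (c₁ := c₁) hpos' ∘ₗ
      (WL2.linearEquiv ℂ ℂ (fun _ : TSite d (towerP L m (n + 1)) => c₀)).symm.toLinearMap, fun _ _ => rfl⟩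
  have hloc : ∀ (v' : TSite d m) (q : TSite d (towerP L m (n + 1)) → W) (F' : ℝ),
      (∀ y, blockCoord (L ^ (n + 1)) m (siteCast (towerP_eq_fineP_pow L m (n + 1)) y) ≠ v' → q y = 0) → (∀ y, ‖q y‖ ≤ F') →
      ∀ y, ‖T q y‖ ≤ BP * Real.exp (-(κP * tdist m (blockCoord (L ^ (n + 1)) m (siteCast (towerP_eq_fineP_pow L m (n + 1)) y)) v')) * F' := by
    intro v' q F' hqv hqF y
    rw [hT]
    exact HP n η hηL c₀ c₁ hw m U hRS α hα hαP' hUb hUη εU hεU hεg hUε hLb hUst hRlev hpos' PS hPS v' y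
      ((WL2.equiv ℂ (fun _ : TSite d (towerP L m (n + 1)) => c₀) W).symm q) F'
      (fun z hz => by rw [Equiv.apply_symm_apply]; exact hqv z hz) (fun z => by rw [Equiv.apply_symm_apply]; exact hqF z)
  have hcorr := weighted_row_of_local (L ^ (n + 1)) m (towerP_eq_fineP_pow L m (n + 1)) hm T
    (fun x : TSite d (towerP L m (n + 1)) => blockCoord (L ^ (n + 1)) m (siteCast (towerP_eq_fineP_pow L m (n + 1)) x))
    hBP0 (by positivity : 0 ≤ (1 + |a'|) * B₁ * F) hδ₂0.le hδ₂1 hδ₂κ hloc v (WL2.equiv ℂ _ W g) hgrow x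
  rw [hT, Equiv.symm_apply_apply] at hcorr
  -- §3 the identity and the assembly
  have hid := GpOfUk_eq_resolvent_add L m n φ η U a' hpos' hpos₁ (covDivL2K ℂ c₀ ((η : ℂ))⁻¹ (adTransportW φ fun b => (U b)⁻¹) f)
  rw [← hwdef, ← hgdef] at hid
  rw [hid, WL2.equiv_add, Pi.add_apply]
  refine (norm_add_le _ _).trans ?_
  have hwk : Real.exp (-(δ₁ * tdist m (blockCoord (L ^ (n + 1)) m (siteCast (towerP_eq_fineP_pow L m (n + 1)) x)) v)) ≤
      Real.exp (-(δ₂ * tdist m (blockCoord (L ^ (n + 1)) m (siteCast (towerP_eq_fineP_pow L m (n + 1)) x)) v)) :=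
    Real.exp_le_exp.2 (by nlinarith [mul_le_mul_of_nonneg_right hδ₂1 (tdist_nonneg m (blockCoord (L ^ (n + 1)) m (siteCast (towerP_eq_fineP_pow L m (n + 1)) x)) v)])
  have hE : 0 ≤ Real.exp (-(δ₂ * tdist m (blockCoord (L ^ (n + 1)) m (siteCast (towerP_eq_fineP_pow L m (n + 1)) x)) v)) := (Real.exp_pos _).le
  calc ‖WL2.equiv ℂ _ W w x‖ + ‖WL2.equiv ℂ _ W (GpOfUk L m n φ η U a' (c₁ := c₁) hpos' g) x‖
      ≤ B₁ * Real.exp (-(δ₁ * tdist m (blockCoord (L ^ (n + 1)) m (siteCast (towerP_eq_fineP_pow L m (n + 1)) x)) v)) * F +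
          BP * latticeConst d (κP - δ₂) * ((1 + |a'|) * B₁ * F) *
            Real.exp (-(δ₂ * tdist m (blockCoord (L ^ (n + 1)) m (siteCast (towerP_eq_fineP_pow L m (n + 1)) x)) v)) := add_le_add (hwrow x) hcorr
    _ ≤ B₁ * Real.exp (-(δ₂ * tdist m (blockCoord (L ^ (n + 1)) m (siteCast (towerP_eq_fineP_pow L m (n + 1)) x)) v)) * F +
          BP * latticeConst d (κP - δ₂) * ((1 + |a'|) * B₁ * F) *
            Real.exp (-(δ₂ * tdist m (blockCoord (L ^ (n + 1)) m (siteCast (towerP_eq_fineP_pow L m (n + 1)) x)) v)) := by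
        gcongr
    _ = (B₁ + BP * latticeConst d (κP - δ₂) * ((1 + |a'|) * B₁)) *
          Real.exp (-(δ₂ * tdist m (blockCoord (L ^ (n + 1)) m (siteCast (towerP_eq_fineP_pow L m (n + 1)) x)) v)) * F := by ring

end Row

end Literature.MathematicalPhysics.QuantumFieldTheory.Balaban1983to89.B9Eq342GreenPrimeDstarValueRowTower

end
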